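import Summits.Ventures.PercRepro.RankLevelSetAvgIdentity
import Summits.Ventures.PercRepro.RankLevelSetAvgLYM
import Summits.Ventures.PercRepro.RankLevelSetAvgPairs

/-!
# PercRepro — [re-pointed at the primed (`_S`) parents per (um)(35)(2)–(4); the landed originals are the citations]
# THE BRIDGES OF THE AVERAGED (MC) ON THE TIGHT LAYER (night-1, gen 9 session 4; dossier §19.12)

The supply of the averaged identity as a sum of rule weights (`supply_eq_sum_ruleWeight`), the demand of a member
split into the uniform part and the excess (`demand_split`), and the two halves of the charging in the vocabulary of
sets: part 1 (`indep_charge_ge_set`, from `indep_charge_ge` through the bijection `UF ≃ U(p,q)`) and part 2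
(`dep_charge_ge_set`, from `dep_charge_pairs_ge` through the injective pairs map `(S₁,S₂) ↦ (E∖A) ∪ S₁ ∪ S₂`).
RankLevelSetAvgAssembly puts them together.

Axioms: standard.
-/
open scoped Matroid

namespace PercRepro

open Set Finset

variable {α : Type} (M : Matroid α) [M.Finite]

open scoped Classical in
/-- The supply of the averaged identity is the total rule weight of the middle sets:
`n·#Y(p,q) − Σ_{T ∈ Y(p,q+1)} |T| = Σ_{T ∈ Y(p,q)} w(T)`. -/
lemma supply_eq_sum_ruleWeight (p q : ℕ) :
    (M.E.ncard : ℚ) * (Matroid.midCount M p q : ℚ) -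
        ∑ T ∈ (Yset_finite M p (q + 1)).toFinset, (T.ncard : ℚ) =
      ∑ T ∈ (Yset_finite M p q).toFinset, ruleWeight M q T := by
  set Yf := (Yset_finite M p q).toFinset with hYf
  set Y1f := (Yset_finite M p (q + 1)).toFinset with hY1f
  -- `Y(p,q+1)` is the part of `Y(p,q)` of rank `> q + 1`
  have hY1 : Y1f = Yf.filter (fun T => ¬ M.eRk T = ((q + 1 : ℕ) : ℕ∞)) := by
    ext T
    simp only [hY1f, hYf, Finset.mem_filter, Set.Finite.mem_toFinset, Yset, Set.mem_setOf_eq]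
    constructor
    · rintro ⟨hTE, hq, hp⟩
      refine ⟨⟨hTE, ?_, hp⟩, ?_⟩
      · exact lt_of_le_of_lt (by exact_mod_cast (Nat.le_succ q)) hq
      · intro h; rw [h] at hq; exact lt_irrefl _ hq
    · rintro ⟨⟨hTE, hq, hp⟩, hne⟩
      refine ⟨hTE, ?_, hp⟩
      have h1 : ((q + 1 : ℕ) : ℕ∞) ≤ M.eRk T := by
        have := (ENat.add_one_le_iff (ENat.coe_ne_top q)).2 hq
        exact_mod_cast this
      exact lt_of_le_of_ne h1 (fun h => hne h.symm)
  set Rf := Yf.filter (fun T => M.eRk T = ((q + 1 : ℕ) : ℕ∞)) with hRf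
  have hsplit : Yf = Y1f ∪ Rf := by
    rw [hY1, hRf, Finset.union_comm, Finset.filter_union_filter_not_eq]
  have hdisj : Disjoint Y1f Rf := by
    rw [hY1, hRf]; exact (Finset.disjoint_filter_filter_not Yf Yf _).symm
  have hmid : (Matroid.midCount M p q : ℚ) = (Yf.card : ℚ) := by
    rw [midCount_eq_ncard_Yset, hYf, Set.ncard_eq_toFinset_card _ (Yset_finite M p q)]
  have hsum : ∑ T ∈ Yf, ruleWeight M q T = ∑ T ∈ Y1f, ruleWeight M q T + ∑ T ∈ Rf, ruleWeight M q T := by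
    rw [hsplit, Finset.sum_union hdisj]
  have hcard : Yf.card = Y1f.card + Rf.card := by
    rw [hsplit, Finset.card_union_of_disjoint hdisj]
  rw [hmid, hsum, hcard]
  have h1 : ∑ T ∈ Y1f, ruleWeight M q T = ∑ T ∈ Y1f, ((M.E.ncard : ℚ) - (T.ncard : ℚ)) := by
    refine Finset.sum_congr rfl (fun T hT => ?_)
    rw [hY1, Finset.mem_filter] at hT
    unfold ruleWeight
    rw [if_neg hT.2]
  have h2 : ∑ T ∈ Rf, ruleWeight M q T = ∑ T ∈ Rf, (M.E.ncard : ℚ) := by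
    refine Finset.sum_congr rfl (fun T hT => ?_)
    rw [hRf, Finset.mem_filter] at hT
    unfold ruleWeight
    rw [if_pos hT.2]
  rw [h1, h2, Finset.sum_sub_distrib, Finset.sum_const, Finset.sum_const, nsmul_eq_mul, nsmul_eq_mul]
  push_cast
  ring

/-- The demand of a member splits into the uniform part and the excess:
`n·Φ − Φ′·|A ∖ cl(E∖A)| = (n·Φ − p·Φ′) + Φ′·|cl(E∖A) ∖ (E∖A)|`. -/
lemma demand_split {p q : ℕ} (hE : M.E.ncard = p + q) {A : Set α} (hA : A ∈ Uset M p q) :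
    (M.E.ncard : ℚ) * phiK p q - phiK (p - 1) q * ((A \ M.closure (M.E \ A)).ncard : ℚ) =
      ((M.E.ncard : ℚ) * phiK p q - (p : ℚ) * phiK (p - 1) q) +
        phiK (p - 1) q * ((M.closure (M.E \ A) \ (M.E \ A)).ncard : ℚ) := by
  have hEfin : M.E.Finite := M.set_finite M.E
  have hAE : A ⊆ M.E := hA.1
  obtain ⟨hAcard, -⟩ := ncard_compl_eq_of_mem_Uset_S M hE hA
  have h1 : (A ∩ M.closure (M.E \ A)).ncard + (A \ M.closure (M.E \ A)).ncard = A.ncard :=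
    Set.ncard_inter_add_ncard_sdiff_eq_ncard A _ (hEfin.subset hAE)
  have h2 : A ∩ M.closure (M.E \ A) = M.closure (M.E \ A) \ (M.E \ A) := by
    ext x
    constructor
    · rintro ⟨hxA, hxF⟩
      exact ⟨hxF, fun h => h.2 hxA⟩
    · rintro ⟨hxF, hxn⟩
      have hxE : x ∈ M.E := M.closure_subset_ground _ hxF
      exact ⟨by_contra (fun h => hxn ⟨hxE, h⟩), hxF⟩
  rw [h2, hAcard] at h1
  have h1q : ((M.closure (M.E \ A) \ (M.E \ A)).ncard : ℚ) + ((A \ M.closure (M.E \ A)).ncard : ℚ) = (p : ℚ) := by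
    exact_mod_cast h1
  have hx : ((A \ M.closure (M.E \ A)).ncard : ℚ) = (p : ℚ) - ((M.closure (M.E \ A) \ (M.E \ A)).ncard : ℚ) := by
    linarith
  rw [hx]
  ring


open scoped Classical in
/-- On the tight layer `U(p,q)` (as a finset of sets) is the image of `UF M p` under the coercion. -/
lemma Uset_toFinset_eq_image_UF {p q : ℕ} (hE : M.E.ncard = p + q) :
    (Uset_finite_S M p q).toFinset = (UF M p).image (fun s : Finset α => (s : Set α)) := by
  have hEfin : M.E.Finite := M.set_finite M.E
  ext A
  rw [Set.Finite.mem_toFinset, Finset.mem_image]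
  constructor
  · intro hA
    have hg := Uset_subset_goodImg M hE hA
    obtain ⟨hgi, hgc⟩ := hg
    rw [mem_indImg_iff] at hgi
    obtain ⟨hAE, hAind, hAcard⟩ := hgi
    have hAfin : A.Finite := hEfin.subset hAE
    refine ⟨hAfin.toFinset, ?_, hAfin.coe_toFinset⟩
    rw [mem_UF, hAfin.coe_toFinset]
    refine ⟨hAE, ?_, hAind, hgc⟩
    rw [← Set.ncard_eq_toFinset_card _ hAfin, ← hAfin.cast_ncard_eq] at *
    exact_mod_cast hAcard
  · rintro ⟨s, hs, rfl⟩
    rw [mem_UF] at hs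
    obtain ⟨hsE, hscard, hsind, hsc⟩ := hs
    refine goodImg_subset_Uset M hE ⟨?_, hsc⟩
    rw [mem_indImg_iff]
    refine ⟨hsE, hsind, ?_⟩
    rw [Set.encard_coe_eq_coe_finsetCard, hscard]

open scoped Classical in
/-- The multiplicity of an independent supply set is the same whether counted over `UF` or over `U(p,q)`. -/
lemma card_filter_UF_eq {p q : ℕ} (hE : M.E.ncard = p + q) (T : Finset α) :
    ((UF M p).filter (fun s' => T ⊆ s')).card =
      ((Uset_finite_S M p q).toFinset.filter (fun A' => (T : Set α) ⊆ A')).card := by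
  rw [Uset_toFinset_eq_image_UF M hE, Finset.filter_image]
  rw [Finset.card_image_of_injOn (fun s _ s' _ h => Finset.coe_injective h)]
  congr 1
  ext s
  simp only [Finset.mem_filter, Finset.coe_subset]

open scoped Classical in
/-- **PART 1, IN THE SET VOCABULARY**: every member `A` of `U(p,q)` receives at least the uniform demand from the
independent middle sets `T ⊆ A`. -/
theorem indep_charge_ge_set {p q : ℕ} (hq : 1 ≤ q) (hpq : q + 2 ≤ p) (hE : M.E.ncard = p + q)
    {A : Set α} (hA : A ∈ Uset M p q) :
    ((p + q : ℕ) : ℚ) * phiK p q - (p : ℚ) * phiK (p - 1) q ≤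
      ∑ T ∈ (Yset_finite M p q).toFinset.filter (fun T => M.Indep T ∧ T ⊆ A),
        ruleWeight M q T / (((Uset_finite_S M p q).toFinset.filter (fun A' => T ⊆ A')).card : ℚ) := by
  have hEfin : M.E.Finite := M.set_finite M.E
  have hAE : A ⊆ M.E := hA.1
  have hAfin : A.Finite := hEfin.subset hAE
  set s : Finset α := hAfin.toFinset with hs_def
  have hs : s ∈ UF M p := by
    have : A ∈ (Uset_finite_S M p q).toFinset := by rw [Set.Finite.mem_toFinset]; exact hA
    rw [Uset_toFinset_eq_image_UF M hE, Finset.mem_image] at this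
    obtain ⟨s', hs', hs'A⟩ := this
    have : s' = s := by
      rw [hs_def]
      apply Finset.coe_injective
      rw [hs'A, hAfin.coe_toFinset]
    rw [← this]; exact hs'
  have hsA : (s : Set α) = A := hAfin.coe_toFinset
  refine le_trans (indep_charge_ge M hq hpq hE hs) (le_of_eq ?_)
  -- the bijection `T ↦ ↑T`
  refine Finset.sum_bij (fun T _ => (T : Set α)) ?_ ?_ ?_ ?_
  · intro T hT
    rw [Finset.mem_filter, Finset.mem_powerset] at hT
    obtain ⟨hTs, hq1, hp1⟩ := hT
    have hTA : (T : Set α) ⊆ A := by rw [← hsA]; exact Finset.coe_subset.2 hTs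
    have hAind : M.Indep A := by
      obtain ⟨hgi, -⟩ := Uset_subset_goodImg M hE hA
      rw [mem_indImg_iff] at hgi
      exact hgi.2.1
    have hTind : M.Indep (T : Set α) := hAind.subset hTA
    rw [Finset.mem_filter, Set.Finite.mem_toFinset]
    refine ⟨⟨hTA.trans hAE, ?_, ?_⟩, hTind, hTA⟩
    · rw [hTind.eRk_eq_encard, Set.encard_coe_eq_coe_finsetCard]
      exact_mod_cast hq1
    · rw [hTind.eRk_eq_encard, Set.encard_coe_eq_coe_finsetCard]
      exact_mod_cast (by omega : T.card < p)
  · intro T _ T' _ h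
    exact Finset.coe_injective h
  · intro T' hT'
    rw [Finset.mem_filter, Set.Finite.mem_toFinset] at hT'
    obtain ⟨⟨hT'E, hq', hp'⟩, hT'ind, hT'A⟩ := hT'
    have hT'fin : T'.Finite := hEfin.subset hT'E
    refine ⟨hT'fin.toFinset, ?_, hT'fin.coe_toFinset⟩
    rw [Finset.mem_filter, Finset.mem_powerset]
    have hcard : hT'fin.toFinset.card = T'.ncard := (Set.ncard_eq_toFinset_card _ hT'fin).symm
    have hrk : M.eRk T' = (T'.ncard : ℕ∞) := by rw [hT'ind.eRk_eq_encard, hT'fin.cast_ncard_eq]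
    rw [hrk] at hq' hp'
    refine ⟨?_, ?_, ?_⟩
    · rw [hs_def, Set.Finite.toFinset_subset_toFinset]; exact hT'A
    · rw [hcard]; exact_mod_cast hq'
    · rw [hcard]
      have : T'.ncard < p := by exact_mod_cast hp'
      omega
  · intro T hT
    rw [Finset.mem_filter, Finset.mem_powerset] at hT
    obtain ⟨hTs, hq1, hp1⟩ := hT
    have hTA : (T : Set α) ⊆ A := by rw [← hsA]; exact Finset.coe_subset.2 hTs
    have hAind : M.Indep A := by
      obtain ⟨hgi, -⟩ := Uset_subset_goodImg M hE hA
      rw [mem_indImg_iff] at hgi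
      exact hgi.2.1
    have hTind : M.Indep (T : Set α) := hAind.subset hTA
    rw [card_filter_UF_eq M hE T]
    congr 1
    -- the weights agree on independent sets
    unfold weightK ruleWeight
    rw [hTind.eRk_eq_encard, Set.encard_coe_eq_coe_finsetCard, hE, Set.ncard_coe_finset]
    by_cases h : T.card = q + 1
    · rw [if_pos h, if_pos (by rw [h])]
    · rw [if_neg h, if_neg (fun h' => h (by exact_mod_cast h'))]
      push_cast
      rw [Nat.cast_sub (by omega)]
      push_cast
      ring


/-- The rule weight is non-negative on subsets of `E`. -/
lemma ruleWeight_nonneg {q : ℕ} {T : Set α} (hT : T ⊆ M.E) : 0 ≤ ruleWeight M q T := by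
  unfold ruleWeight
  split_ifs
  · positivity
  · have : T.ncard ≤ M.E.ncard := Set.ncard_le_ncard hT (M.set_finite M.E)
    have h' : (T.ncard : ℚ) ≤ (M.E.ncard : ℚ) := by exact_mod_cast this
    linarith

open scoped Classical in
/-- **PART 2, IN THE SET VOCABULARY**: every member `A` of `U(p,q)` receives at least `NUM′(p, q, k_A)` from the
dependent middle sets `T ⊇ E ∖ A`, `k_A = |cl(E∖A) ∖ (E∖A)|`. -/
theorem dep_charge_ge_set {p q : ℕ} (hq : 1 ≤ q) (hpq : q + 2 ≤ p) (hE : M.E.ncard = p + q)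
    {A : Set α} (hA : A ∈ Uset M p q) :
    numPrime p q (M.closure (M.E \ A) \ (M.E \ A)).ncard ≤
      ∑ T ∈ (Yset_finite M p q).toFinset.filter (fun T => ¬ M.Indep T ∧ M.E \ A ⊆ T),
        ruleWeight M q T / (((Uset_finite_S M p q).toFinset.filter (fun A' => M.E \ A' ⊆ T)).card : ℚ) := by
  have hEfin : M.E.Finite := M.set_finite M.E
  have hAE : A ⊆ M.E := hA.1
  set F := M.closure (M.E \ A) with hF
  have hKfin : (F \ (M.E \ A)).Finite := hEfin.subset (sdiff_subset.trans (M.closure_subset_ground _))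
  have hXfin : (A \ F).Finite := hEfin.subset (sdiff_subset.trans hAE)
  set KF := hKfin.toFinset with hKF
  set XF := hXfin.toFinset with hXF
  have hK : (KF : Set α) = F \ (M.E \ A) := hKfin.coe_toFinset
  have hX : (XF : Set α) = A \ F := hXfin.coe_toFinset
  have hk : (F \ (M.E \ A)).ncard = KF.card := Set.ncard_eq_toFinset_card _ hKfin
  rw [hk]
  refine le_trans (dep_charge_pairs_ge M hq hpq hE hA KF XF hK hX) ?_
  -- the pairs map into the dependent supply sets containing `E ∖ A`
  set P₁ := KF.powerset.filter (fun S₁ => 1 ≤ S₁.card) with hP₁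
  set P₂ := XF.powerset.filter (fun S₂ => 1 ≤ S₂.card ∧ S₂.card ≤ p - q - 1) with hP₂
  let Tm : Finset α × Finset α → Set α := fun x => (M.E \ A) ∪ (x.1 : Set α) ∪ (x.2 : Set α)
  let f : Set α → ℚ := fun T => ruleWeight M q T /
    (((Uset_finite_S M p q).toFinset.filter (fun A' => M.E \ A' ⊆ T)).card : ℚ)
  have hrm : ∀ T, ((ruleMult M p q T : ℕ) : ℚ) =
      (((Uset_finite_S M p q).toFinset.filter (fun A' => M.E \ A' ⊆ T)).card : ℚ) := by
    intro T; unfold ruleMult; congr 2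
  have hsum : ∑ S₁ ∈ P₁, ∑ S₂ ∈ P₂, ruleWeight M q ((M.E \ A) ∪ (S₁ : Set α) ∪ (S₂ : Set α)) /
      ((ruleMult M p q ((M.E \ A) ∪ (S₁ : Set α) ∪ (S₂ : Set α)) : ℕ) : ℚ) =
      ∑ x ∈ P₁ ×ˢ P₂, f (Tm x) := by
    rw [Finset.sum_product]
    refine Finset.sum_congr rfl (fun S₁ _ => Finset.sum_congr rfl (fun S₂ _ => ?_))
    simp only [f, Tm, hrm]
  rw [hsum]
  -- injectivity of the pairs map on `P₁ ×ˢ P₂`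
  have hinj : Set.InjOn Tm ↑(P₁ ×ˢ P₂) := by
    intro x hx y hy hxy
    rw [Finset.coe_product, Set.mem_prod, Finset.mem_coe, Finset.mem_coe, hP₁, hP₂,
      Finset.mem_filter, Finset.mem_filter, Finset.mem_powerset, Finset.mem_powerset] at hx hy
    have hx1 : (x.1 : Set α) ⊆ F \ (M.E \ A) := by rw [← hK]; exact Finset.coe_subset.2 hx.1.1
    have hx2 : (x.2 : Set α) ⊆ A \ F := by rw [← hX]; exact Finset.coe_subset.2 hx.2.1
    have hy1 : (y.1 : Set α) ⊆ F \ (M.E \ A) := by rw [← hK]; exact Finset.coe_subset.2 hy.1.1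
    have hy2 : (y.2 : Set α) ⊆ A \ F := by rw [← hX]; exact Finset.coe_subset.2 hy.2.1
    -- `S₁ = T ∩ (F ∖ (E∖A))` and `S₂ = T ∩ (A ∖ F)`
    have key1 : ∀ (S₁ S₂ : Finset α), (S₁ : Set α) ⊆ F \ (M.E \ A) → (S₂ : Set α) ⊆ A \ F →
        ((M.E \ A) ∪ (S₁ : Set α) ∪ (S₂ : Set α)) ∩ (F \ (M.E \ A)) = (S₁ : Set α) := by
      intro S₁ S₂ h1 h2
      ext z
      constructor
      · rintro ⟨(hz | hz) | hz, hzK⟩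
        · exact absurd hz hzK.2
        · exact hz
        · exact absurd hzK.1 (h2 hz).2
      · intro hz
        exact ⟨Or.inl (Or.inr hz), h1 hz⟩
    have key2 : ∀ (S₁ S₂ : Finset α), (S₁ : Set α) ⊆ F \ (M.E \ A) → (S₂ : Set α) ⊆ A \ F →
        ((M.E \ A) ∪ (S₁ : Set α) ∪ (S₂ : Set α)) ∩ (A \ F) = (S₂ : Set α) := by
      intro S₁ S₂ h1 h2
      ext z
      constructor
      · rintro ⟨(hz | hz) | hz, hzX⟩
        · exact absurd hzX.1 hz.2
        · exact absurd (h1 hz).1 hzX.2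
        · exact hz
      · intro hz
        exact ⟨Or.inr hz, h2 hz⟩
    have e1 : (x.1 : Set α) = (y.1 : Set α) := by
      rw [← key1 x.1 x.2 hx1 hx2, ← key1 y.1 y.2 hy1 hy2]
      exact congrArg (fun T => T ∩ (F \ (M.E \ A))) hxy
    have e2 : (x.2 : Set α) = (y.2 : Set α) := by
      rw [← key2 x.1 x.2 hx1 hx2, ← key2 y.1 y.2 hy1 hy2]
      exact congrArg (fun T => T ∩ (A \ F)) hxy
    exact Prod.ext (Finset.coe_injective e1) (Finset.coe_injective e2)
  rw [← Finset.sum_image hinj]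
  -- the image lies in the dependent supply sets containing `E ∖ A`, and `f ≥ 0`
  refine Finset.sum_le_sum_of_subset_of_nonneg ?_ ?_
  · intro T hT
    rw [Finset.mem_image] at hT
    obtain ⟨x, hx, rfl⟩ := hT
    rw [Finset.mem_product, hP₁, hP₂, Finset.mem_filter, Finset.mem_filter, Finset.mem_powerset,
      Finset.mem_powerset] at hx
    have hx1 : (x.1 : Set α) ⊆ F \ (M.E \ A) := by rw [← hK]; exact Finset.coe_subset.2 hx.1.1
    have hx2 : (x.2 : Set α) ⊆ A \ F := by rw [← hX]; exact Finset.coe_subset.2 hx.2.1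
    have hne1 : (x.1 : Set α).Nonempty := by
      rw [Finset.coe_nonempty, ← Finset.card_pos]; exact hx.1.2
    have hne2 : (x.2 : Set α).Nonempty := by
      rw [Finset.coe_nonempty, ← Finset.card_pos]; exact hx.2.2.1
    obtain ⟨hdep, hlo, hhi⟩ := supply_set_spec_S M hE hA hx1 hne1 hx2 hne2
    rw [Finset.mem_filter, Set.Finite.mem_toFinset]
    refine ⟨⟨?_, ?_, ?_⟩, hdep, fun z hz => Or.inl (Or.inl hz)⟩
    · -- `T ⊆ E`
      intro z hz
      rcases hz with (hz | hz) | hz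
      · exact hz.1
      · exact M.closure_subset_ground _ (hx1 hz).1
      · exact hAE (hx2 hz).1
    · exact lt_of_lt_of_le (by exact_mod_cast (Nat.lt_succ_self q)) hlo
    · refine lt_of_le_of_lt hhi ?_
      rw [Set.encard_coe_eq_coe_finsetCard]
      have : q + x.2.card < p := by omega
      exact_mod_cast this
  · intro T hT _
    rw [Finset.mem_filter, Set.Finite.mem_toFinset] at hT
    exact div_nonneg (ruleWeight_nonneg M hT.1.1) (Nat.cast_nonneg _)


end PercRepro
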